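import Summits.NavierStokesRegularity.FluidComputer.RotorKnobCritical
import HarnessLib

/-!
# The seed–rotor scale knob, part 4 of 6: (c-large), (cgrow-2), equipartition, (atc)

Part 4 of `RotorKnob*.lean` (cell `pub-fluidc`, blueprint seat bp1, gen 22; namespace
`Summit.NavierStokesRegularity.FluidComputer.RotorKnob`).
HONEST FRAMING: low prior, high value-of-information experiment on Tao's machine paradigm; NOT a
claim that NS blows up.
Five-mode ODE analysis of [Tao2016AveragedNS, §5.5] with the clock/amplifier scale `ε` and the
seed/rotor scale `ρ` kept apart; nothing is proved about Navier–Stokes.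

THIS FILE: the growth bound `c_growth` (`c ≥ K⁻¹⁰ρ²e^{M(t-τ)/8}` on `[τ,2]`) and (c-large)
`c_large` (`c ≥ K¹⁰⁰ρ²` on `[τ + δ, 2]` once `e^{Mδ/8} ≥ K¹¹⁰`); (cgrow-2) `c_deriv_bounds`
(`0 ≤ ∂ₜc ≤ 6K¹⁰c`); the equipartition corrector `V = adρ²/c` (`hasDerivAt_V`:
`∂ₜV = (a² - d²) + R`; `V_remainder_le`: `|R| ≤ 9K⁻⁹⁰`, the seed–rotor scale entering only
through `ρ²/c ≤ K⁻¹⁰⁰`); (atc) `e_tenth` — `ã(τ + δ + 1/K) ≥ 1/10`.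
[cite: Tao2016AveragedNS, §5.5 (c-large), (cgrow-2), (douse), (atc)]. No named facts; 0 sorry.
-/

noncomputable section

namespace Summit.NavierStokesRegularity.FluidComputer.RotorKnob

open Set Real Filter
open _root_.Topology
open Literature.Analysis.FluidPDE.Tao2016AveragedNS
open Literature.Analysis.FluidPDE.Tao2016AveragedNS.Thm53 (antitoneOn_intFactor monotoneOn_intFactor
  antitoneOn_sub_of_deriv_le monotoneOn_sub_of_le_deriv exists_hitTime abs_sub_le_of_abs_deriv_le
  sqrt_two_gt sqrt_two_lt invSqrt_facts Es_alg decay_alg numeric_N4 init_a init_b init_c init_d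
  init_e)

variable {K M ε ρ τ δ : ℝ} {X : ℝ → Fin 5 → ℝ}

/-- Exponential growth after `t_c`: `c(t) ≥ K⁻¹⁰ρ² exp(M(t-τ)/8)` on `[τ,2]` (from
`∂ₜc ≥ νbc ≥ (M/8)c`). [cite: Tao2016AveragedNS, §5.5 (c-large)] -/
theorem c_growth (hX : ∀ t, HasDerivAt X (rotorCircuit K M ε ρ (X t)) t) (h0 : X 0 = delayInit)
    (hε : 0 < ε) (hρ : 0 < ρ) (hρε : ρ ^ 2 ≤ ε) (hM0 : 0 < M) (hK : 16 ≤ K)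
    (hεK : ε ^ 2 ≤ 1 / (6 * K ^ 20)) (hMρ : M * ρ ^ 4 ≤ ε ^ 2)
    (hρexp : ρ ^ 4 ≤ ε ^ 2 * exp (-(18 * M)) / (64 * M))
    (hτ1 : 1 ≤ τ) (hτ2 : τ ≤ 2)
    (hcτ : ∀ t, 0 ≤ t → t ≤ τ → X t 2 ≤ ρ ^ 2 / K ^ 10) (hcτeq : X τ 2 = ρ ^ 2 / K ^ 10)
    {t : ℝ} (ht : t ∈ Icc τ 2) :
    ρ ^ 2 / K ^ 10 * exp (M * (t - τ) / 8) ≤ X t 2 := by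
  have hK0 : 0 < K := by linarith
  set k : ℝ := M with hk
  have hk0 : 0 < k := hM0
  have hmono := monotoneOn_intFactor (s := Icc τ 2) (g := fun _ => k / 8)
    (G := fun s => k / 8 * s) (φ := fun _ => 0) (Φ := fun _ => 0) (convex_Icc τ 2)
    (fun s _ => hasDerivAt_c hX s)
    (fun s _ => ((hasDerivAt_id s).const_mul (k / 8)).congr_deriv (by simp))
    (fun s _ => hasDerivAt_const s (0 : ℝ))
    (fun s hs => by
      have hc0 : 0 ≤ X s 2 := c_nonneg hX h0 (by linarith [hs.1])
      have hb : ε / 8 ≤ X s 1 := b_lower_after hX h0 hε hρ hρε hM0 hK hεK hMρ hρexp hτ1 hτ2 hcτ hs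
      have hνb : k / 8 ≤ ε⁻¹ * M * X s 1 := by
        calc k / 8 = ε⁻¹ * M * (ε / 8) := by simp only [hk]; field_simp
          _ ≤ ε⁻¹ * M * X s 1 := mul_le_mul_of_nonneg_left hb (by positivity)
      have h1 : k / 8 * X s 2 ≤ ε⁻¹ * M * X s 1 * X s 2 :=
        mul_le_mul_of_nonneg_right hνb hc0
      have h2 : 0 ≤ ρ ^ 2 * exp (-M) * X s 0 ^ 2 := by positivity
      have : 0 ≤ ρ ^ 2 * exp (-M) * X s 0 ^ 2 + ε⁻¹ * M * X s 1 * X s 2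
          - k / 8 * X s 2 := by linarith
      exact mul_nonneg this (exp_pos _).le)
  have hτmem : τ ∈ Icc τ 2 := ⟨le_rfl, hτ2⟩
  have h := hmono hτmem ht ht.1
  simp only [sub_zero, hcτeq] at h
  have hE : X t 2 = X t 2 * exp (-(k / 8 * t)) * exp (k / 8 * t) := by
    rw [mul_assoc, ← exp_add, neg_add_cancel, exp_zero, mul_one]
  rw [hE]
  calc ρ ^ 2 / K ^ 10 * exp (k * (t - τ) / 8)
      = ρ ^ 2 / K ^ 10 * exp (-(k / 8 * τ)) * exp (k / 8 * t) := by
        rw [mul_assoc, ← exp_add]; congr 2; simp only [hk]; ring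
    _ ≤ X t 2 * exp (-(k / 8 * t)) * exp (k / 8 * t) :=
        mul_le_mul_of_nonneg_right h (exp_pos _).le

/-- (c-large): `c ≥ K¹⁰⁰ρ²` on `I = [τ + δ, 2]` for any onset delay `δ ≥ 0` with
`e^{Mδ/8} ≥ K¹¹⁰` (Tao, `M = K¹⁰`: `δ = K⁻⁹` via `e^{K/8} ≥ K¹¹⁰`; for the family
`δ = 880 log K / M`
exactly): "the rotor gate will be continuously and strongly activated from time `t_c + δ` onwards".
[cite: Tao2016AveragedNS, §5.5 (c-large)] -/
theorem c_large (hX : ∀ t, HasDerivAt X (rotorCircuit K M ε ρ (X t)) t) (h0 : X 0 = delayInit)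
    (hε : 0 < ε) (hρ : 0 < ρ) (hρε : ρ ^ 2 ≤ ε) (hM0 : 0 < M) (hK : 16 ≤ K)
    (hεK : ε ^ 2 ≤ 1 / (6 * K ^ 20)) (hMρ : M * ρ ^ 4 ≤ ε ^ 2)
    (hρexp : ρ ^ 4 ≤ ε ^ 2 * exp (-(18 * M)) / (64 * M)) (hδ : 0 ≤ δ)
    (hon : K ^ 110 ≤ exp (M * δ / 8))
    (hτ1 : 1 ≤ τ) (hτ2 : τ ≤ 2)
    (hcτ : ∀ t, 0 ≤ t → t ≤ τ → X t 2 ≤ ρ ^ 2 / K ^ 10) (hcτeq : X τ 2 = ρ ^ 2 / K ^ 10)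
    {t : ℝ} (ht : t ∈ Icc (τ + δ) 2) : K ^ 100 * ρ ^ 2 ≤ X t 2 := by
  have hK0 : 0 < K := by linarith
  have ht' : t ∈ Icc τ 2 := ⟨by linarith [ht.1], ht.2⟩
  have hg := c_growth hX h0 hε hρ hρε hM0 hK hεK hMρ hρexp hτ1 hτ2 hcτ hcτeq ht'
  have hexp : M * δ / 8 ≤ M * (t - τ) / 8 := by
    have h1 : δ ≤ t - τ := by linarith [ht.1]
    have h2 : M * δ ≤ M * (t - τ) := mul_le_mul_of_nonneg_left h1 hM0.le
    linarith
  calc K ^ 100 * ρ ^ 2 = ρ ^ 2 / K ^ 10 * K ^ 110 := by field_simp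
    _ ≤ ρ ^ 2 / K ^ 10 * exp (M * δ / 8) := mul_le_mul_of_nonneg_left hon (by positivity)
    _ ≤ ρ ^ 2 / K ^ 10 * exp (M * (t - τ) / 8) :=
        mul_le_mul_of_nonneg_left (exp_le_exp.2 hexp) (by positivity)
    _ ≤ X t 2 := hg

/-- (cgrow-2): on `I`, `0 ≤ ∂ₜc ≤ 6K¹⁰c`. [cite: Tao2016AveragedNS, §5.5 (cgrow-2)] -/
theorem c_deriv_bounds (hX : ∀ t, HasDerivAt X (rotorCircuit K M ε ρ (X t)) t)
    (h0 : X 0 = delayInit)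
    (hε : 0 < ε) (hρ : 0 < ρ) (hρε : ρ ^ 2 ≤ ε) (hM0 : 0 < M) (hMK : M ≤ K ^ 10) (hK : 16 ≤ K)
    (hεK : ε ^ 2 ≤ 1 / (6 * K ^ 20)) (hMρ : M * ρ ^ 4 ≤ ε ^ 2)
    (hρexp : ρ ^ 4 ≤ ε ^ 2 * exp (-(18 * M)) / (64 * M)) (hδ : 0 ≤ δ)
    (hon : K ^ 110 ≤ exp (M * δ / 8))
    (hτ1 : 1 ≤ τ) (hτ2 : τ ≤ 2)
    (hcτ : ∀ t, 0 ≤ t → t ≤ τ → X t 2 ≤ ρ ^ 2 / K ^ 10) (hcτeq : X τ 2 = ρ ^ 2 / K ^ 10)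
    {t : ℝ} (ht : t ∈ Icc (τ + δ) 2) :
    0 ≤ ρ ^ 2 * exp (-M) * X t 0 ^ 2 + ε⁻¹ * M * X t 1 * X t 2 ∧
      ρ ^ 2 * exp (-M) * X t 0 ^ 2 + ε⁻¹ * M * X t 1 * X t 2 ≤ 6 * K ^ 10 * X t 2 := by
  have hK0 : 0 < K := by linarith
  have ht' : t ∈ Icc τ 2 := ⟨by linarith [ht.1], ht.2⟩
  have ht02 : t ∈ Icc (0 : ℝ) 2 := ⟨by linarith [ht'.1], ht.2⟩
  have hc0 : 0 ≤ X t 2 := c_nonneg hX h0 ht02.1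
  have hcl : K ^ 100 * ρ ^ 2 ≤ X t 2 :=
      c_large hX h0 hε hρ hρε hM0 hK hεK hMρ hρexp hδ hon hτ1 hτ2 hcτ hcτeq ht
  have hb : ε / 8 ≤ X t 1 := b_lower_after hX h0 hε hρ hρε hM0 hK hεK hMρ hρexp hτ1 hτ2 hcτ ht'
  have hb5 : |X t 1| ≤ 5 * ε := (bc_small hX h0 hε hρ hρε hM0.le ht02).1
  have ha : X t 0 ^ 2 ≤ 1 := traj_sq_le_one hX h0 t 0
  constructor
  · have h1 : 0 ≤ ε⁻¹ * M * X t 1 * X t 2 := by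
      have : 0 ≤ X t 1 := by linarith [hε.le]
      have := hM0.le
      positivity
    have := hM0.le
    positivity
  · -- `μ a² ≤ ρ² ≤ K¹⁰⁰ ρ² ≤ c ≤ K¹⁰ c` and `ν b c ≤ 5 K¹⁰ c`
    have hek : exp (-M) ≤ 1 := by rw [exp_le_one_iff, neg_nonpos]; exact hM0.le
    have h1 : ρ ^ 2 * exp (-M) * X t 0 ^ 2 ≤ K ^ 10 * X t 2 := by
      calc ρ ^ 2 * exp (-M) * X t 0 ^ 2 ≤ ρ ^ 2 * 1 * 1 :=
            mul_le_mul (mul_le_mul_of_nonneg_left hek (by positivity)) ha (by positivity)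
              (by positivity)
        _ ≤ K ^ 100 * ρ ^ 2 := by
            have : (1 : ℝ) ≤ K ^ 100 := one_le_pow₀ (by linarith)
            nlinarith [pow_pos hρ 2]
        _ ≤ X t 2 := hcl
        _ ≤ K ^ 10 * X t 2 := by
            have : (1 : ℝ) ≤ K ^ 10 := one_le_pow₀ (by linarith)
            nlinarith
    have h2 : ε⁻¹ * M * X t 1 * X t 2 ≤ 5 * K ^ 10 * X t 2 := by
      have hb' : X t 1 ≤ 5 * ε := (le_abs_self _).trans hb5
      have h5 : ε⁻¹ * X t 1 ≤ 5 := by rw [inv_mul_le_iff₀ hε]; linarith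
      have : ε⁻¹ * M * X t 1 * X t 2 = (ε⁻¹ * X t 1) * (M * X t 2) := by ring
      rw [this]
      have hkc : 0 ≤ M * X t 2 := mul_nonneg hM0.le hc0
      have hMc : M * X t 2 ≤ K ^ 10 * X t 2 := mul_le_mul_of_nonneg_right hMK hc0
      nlinarith
    linarith

/-! ## Equipartition: the corrector `V = a d ρ²/c` and (douse) -/

/-- The equipartition corrector `V = a·d·ρ²/c` has `∂ₜV = (a² - d²) + R` with the explicit
remainder `R = -(εabd + μacd + Kadã)ρ²/c - ad(ρ²/c)(∂ₜc/c)` (product rule; the rotor terms give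
exactly `ρ⁻²c·(a²-d²)·ρ²/c = a² - d²`). [cite: Tao2016AveragedNS, §5.5 (douse)] -/
theorem hasDerivAt_V (hX : ∀ t, HasDerivAt X (rotorCircuit K M ε ρ (X t)) t) (hε : ε ≠ 0)
    (hρ : ρ ≠ 0) {t : ℝ} (hc : X t 2 ≠ 0) :
    HasDerivAt (fun s => X s 0 * X s 3 * (ρ ^ 2 * (X s 2)⁻¹))
      ((X t 0 ^ 2 - X t 3 ^ 2) +
        (-(ε * X t 0 * X t 1 * X t 3 + ρ ^ 2 * exp (-M) * X t 0 * X t 2 * X t 3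
            + K * X t 0 * X t 3 * X t 4) * (ρ ^ 2 * (X t 2)⁻¹)
          - X t 0 * X t 3 * (ρ ^ 2 * (X t 2)⁻¹) *
            ((ρ ^ 2 * exp (-M) * X t 0 ^ 2 + ε⁻¹ * M * X t 1 * X t 2) * (X t 2)⁻¹))) t := by
  have h1 := (hasDerivAt_a hX t).fun_mul (hasDerivAt_d hX t)
  have h2 := ((hasDerivAt_c hX t).fun_inv hc).const_mul (ρ ^ 2)
  refine (h1.fun_mul h2).congr_deriv ?_
  field_simp
  ring

/-- Size of the remainder in `∂ₜV` on `I`: `|R| ≤ 9K⁻⁹⁰` (uses `ρ²/c ≤ K⁻¹⁰⁰`, `0 ≤ ∂ₜc ≤ 6K¹⁰c`,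
all modes `O(1)`). [cite: Tao2016AveragedNS, §5.5 (douse)] -/
theorem V_remainder_le (hX : ∀ t, HasDerivAt X (rotorCircuit K M ε ρ (X t)) t)
    (h0 : X 0 = delayInit)
    (hε : 0 < ε) (hε1 : ε ≤ 1) (hρ : 0 < ρ) (hρε : ρ ^ 2 ≤ ε) (hM0 : 0 < M) (hMK : M ≤ K ^ 10)
    (hK : 16 ≤ K) (hεK : ε ^ 2 ≤ 1 / (6 * K ^ 20)) (hMρ : M * ρ ^ 4 ≤ ε ^ 2)
    (hρexp : ρ ^ 4 ≤ ε ^ 2 * exp (-(18 * M)) / (64 * M)) (hδ : 0 ≤ δ)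
    (hon : K ^ 110 ≤ exp (M * δ / 8))
    (hτ1 : 1 ≤ τ) (hτ2 : τ ≤ 2)
    (hcτ : ∀ t, 0 ≤ t → t ≤ τ → X t 2 ≤ ρ ^ 2 / K ^ 10) (hcτeq : X τ 2 = ρ ^ 2 / K ^ 10)
    {t : ℝ} (ht : t ∈ Icc (τ + δ) 2) :
    |(-(ε * X t 0 * X t 1 * X t 3 + ρ ^ 2 * exp (-M) * X t 0 * X t 2 * X t 3
            + K * X t 0 * X t 3 * X t 4) * (ρ ^ 2 * (X t 2)⁻¹)
          - X t 0 * X t 3 * (ρ ^ 2 * (X t 2)⁻¹) *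
            ((ρ ^ 2 * exp (-M) * X t 0 ^ 2 + ε⁻¹ * M * X t 1 * X t 2) * (X t 2)⁻¹))|
      ≤ 9 / K ^ 90 := by
  have hK0 : 0 < K := by linarith
  have hK1 : 1 ≤ K := by linarith
  have hcl : K ^ 100 * ρ ^ 2 ≤ X t 2 :=
      c_large hX h0 hε hρ hρε hM0 hK hεK hMρ hρexp hδ hon hτ1 hτ2 hcτ hcτeq ht
  have hcpos : 0 < X t 2 := lt_of_lt_of_le (by positivity) hcl
  obtain ⟨hc'0, hc'6⟩ :=
      c_deriv_bounds hX h0 hε hρ hρε hM0 hMK hK hεK hMρ hρexp hδ hon hτ1 hτ2 hcτ hcτeq ht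
  set q : ℝ := ρ ^ 2 * (X t 2)⁻¹ with hq
  have hq0 : 0 ≤ q := by positivity
  have hq1 : q ≤ 1 / K ^ 100 := by
    simp only [hq]
    rw [← div_eq_mul_inv, div_le_div_iff₀ hcpos (by positivity), one_mul]
    linarith
  set c' : ℝ := ρ ^ 2 * exp (-M) * X t 0 ^ 2 + ε⁻¹ * M * X t 1 * X t 2 with hc'
  have hrat0 : 0 ≤ c' * (X t 2)⁻¹ := by positivity
  have hrat : c' * (X t 2)⁻¹ ≤ 6 * K ^ 10 := by
    rw [← div_eq_mul_inv, div_le_iff₀ hcpos]; exact hc'6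
  have ha : |X t 0| ≤ 1 := traj_abs_le_one hX h0 t 0
  have hb : |X t 1| ≤ 1 := traj_abs_le_one hX h0 t 1
  have hc : |X t 2| ≤ 1 := traj_abs_le_one hX h0 t 2
  have hd : |X t 3| ≤ 1 := traj_abs_le_one hX h0 t 3
  have he : |X t 4| ≤ 1 := traj_abs_le_one hX h0 t 4
  have hμ1 : ρ ^ 2 * exp (-M) ≤ 1 := by
    have hek : exp (-M) ≤ 1 := by rw [exp_le_one_iff, neg_nonpos]; exact hM0.le
    calc ρ ^ 2 * exp (-M) ≤ ε * 1 := mul_le_mul hρε hek (exp_pos _).le hε.le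
      _ ≤ 1 := by rw [mul_one]; exact hε1
  -- term 1
  have hT1 : |(-(ε * X t 0 * X t 1 * X t 3 + ρ ^ 2 * exp (-M) * X t 0 * X t 2 * X t 3
      + K * X t 0 * X t 3 * X t 4) * q)| ≤ (2 + K) * (1 / K ^ 100) := by
    rw [abs_mul, abs_neg, abs_of_nonneg hq0]
    have hin : |ε * X t 0 * X t 1 * X t 3 + ρ ^ 2 * exp (-M) * X t 0 * X t 2 * X t 3
        + K * X t 0 * X t 3 * X t 4| ≤ 2 + K := by
      have e1 : |ε * X t 0 * X t 1 * X t 3| ≤ 1 := by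
        rw [abs_mul, abs_mul, abs_mul, abs_of_pos hε]
        calc ε * |X t 0| * |X t 1| * |X t 3| ≤ 1 * 1 * 1 * 1 := by
              gcongr
          _ = 1 := by ring
      have e2 : |ρ ^ 2 * exp (-M) * X t 0 * X t 2 * X t 3| ≤ 1 := by
        rw [abs_mul, abs_mul, abs_mul, abs_of_nonneg (by positivity : 0 ≤ ρ ^ 2 * exp (-M))]
        calc ρ ^ 2 * exp (-M) * |X t 0| * |X t 2| * |X t 3| ≤ 1 * 1 * 1 * 1 := by
              gcongr
          _ = 1 := by ring
      have e3 : |K * X t 0 * X t 3 * X t 4| ≤ K := by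
        rw [abs_mul, abs_mul, abs_mul, abs_of_pos hK0]
        calc K * |X t 0| * |X t 3| * |X t 4| ≤ K * 1 * 1 * 1 := by gcongr
          _ = K := by ring
      calc _ ≤ |ε * X t 0 * X t 1 * X t 3 + ρ ^ 2 * exp (-M) * X t 0 * X t 2 * X t 3|
            + |K * X t 0 * X t 3 * X t 4| := abs_add_le _ _
        _ ≤ |ε * X t 0 * X t 1 * X t 3| + |ρ ^ 2 * exp (-M) * X t 0 * X t 2 * X t 3|
            + |K * X t 0 * X t 3 * X t 4| := by
            have := abs_add_le (ε * X t 0 * X t 1 * X t 3)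
              (ρ ^ 2 * exp (-M) * X t 0 * X t 2 * X t 3)
            linarith
        _ ≤ 2 + K := by linarith
    exact mul_le_mul hin hq1 hq0 (by positivity)
  -- term 2
  have hT2 : |X t 0 * X t 3 * q * (c' * (X t 2)⁻¹)| ≤ 6 * K ^ 10 * (1 / K ^ 100) := by
    rw [abs_mul, abs_mul, abs_mul, abs_of_nonneg hq0, abs_of_nonneg hrat0]
    calc |X t 0| * |X t 3| * q * (c' * (X t 2)⁻¹) ≤ 1 * 1 * (1 / K ^ 100) * (6 * K ^ 10) := by
          gcongr
      _ = 6 * K ^ 10 * (1 / K ^ 100) := by ring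
  have hsum : (2 + K) * (1 / K ^ 100) + 6 * K ^ 10 * (1 / K ^ 100) ≤ 9 / K ^ 90 := by
    have h10 : 2 + K ≤ 3 * K ^ 10 := by
      have : K ≤ K ^ 10 := le_self_pow₀ hK1 (by norm_num)
      linarith
    rw [show 9 / K ^ 90 = 9 * K ^ 10 * (1 / K ^ 100) by field_simp]
    have : 0 ≤ 1 / K ^ 100 := by positivity
    nlinarith
  calc _ ≤ |(-(ε * X t 0 * X t 1 * X t 3 + ρ ^ 2 * exp (-M) * X t 0 * X t 2 * X t 3
        + K * X t 0 * X t 3 * X t 4) * q)| + |X t 0 * X t 3 * q * (c' * (X t 2)⁻¹)| :=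
        abs_sub _ _
    _ ≤ (2 + K) * (1 / K ^ 100) + 6 * K ^ 10 * (1 / K ^ 100) := add_le_add hT1 hT2
    _ ≤ 9 / K ^ 90 := hsum




/-! ## The claim (atc): `ã(t_c + 1/K) ≥ 1/10` -/


/-- **(atc)** with onset `σ = t_c + δ`: `ã(σ + 1/K) ≥ 1/10`. If not, on `J = [σ, σ + 1/K]` one has
`ã ≤ 1/10`, hence `a² + d² ≥ 0.98`, while `Ψ = V + 2ã/K` has `∂ₜΨ = a² + d² + O(K⁻⁹⁰)` and total
variation `≤ 2K⁻¹⁰⁰ + 0.2/K` over `J` — a contradiction. [cite: Tao2016AveragedNS, §5.5 (atc)] -/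
theorem e_tenth (hX : ∀ t, HasDerivAt X (rotorCircuit K M ε ρ (X t)) t) (h0 : X 0 = delayInit)
    (hε : 0 < ε) (hε1 : ε ≤ 1) (hρ : 0 < ρ) (hρε : ρ ^ 2 ≤ ε) (hM0 : 0 < M) (hMK : M ≤ K ^ 10)
    (hK : 16 ≤ K) (hεK : ε ^ 2 ≤ 1 / (6 * K ^ 20)) (hMρ : M * ρ ^ 4 ≤ ε ^ 2)
    (hρexp : ρ ^ 4 ≤ ε ^ 2 * exp (-(18 * M)) / (64 * M)) (hδ : 0 ≤ δ)
    (hon : K ^ 110 ≤ exp (M * δ / 8))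
    (hτ1 : 1 ≤ τ) (hfit : τ + δ + (sqrt K)⁻¹ ≤ 2)
    (hcτ : ∀ t, 0 ≤ t → t ≤ τ → X t 2 ≤ ρ ^ 2 / K ^ 10) (hcτeq : X τ 2 = ρ ^ 2 / K ^ 10) :
    1 / 10 ≤ X (τ + δ + K⁻¹) 4 := by
  have hK0 : 0 < K := by linarith
  have hK1 : 1 ≤ K := by linarith
  have hsK : K⁻¹ ≤ (sqrt K)⁻¹ := by
    rw [inv_le_inv₀ hK0 (by positivity)]
    calc sqrt K ≤ sqrt K * sqrt K :=
          le_mul_of_one_le_right (by positivity) (by linarith [(invSqrt_facts hK).2.2.2.1])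
      _ = K := mul_self_sqrt hK0.le
  have hu0' : 0 < K⁻¹ := inv_pos.2 hK0
  have hτ2 : τ ≤ 2 := by linarith
  have ht12' : τ + δ + K⁻¹ ≤ 2 := by linarith
  set t₀ : ℝ := τ + δ with ht₀
  set t₁ : ℝ := τ + δ + K⁻¹ with ht₁
  have ht₀0 : 0 ≤ t₀ := by simp only [ht₀]; linarith
  have hKinv : K⁻¹ ≤ 1 / 16 := by rw [inv_le_comm₀ hK0 (by norm_num)]; linarith
  have h01 : t₀ ≤ t₁ := by simp only [ht₀, ht₁]; linarith
  have ht12 : t₁ ≤ 2 := by simp only [ht₁]; linarith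
  have hJI : ∀ s ∈ Icc t₀ t₁, s ∈ Icc (τ + δ) 2 := fun s hs => ⟨hs.1, hs.2.trans ht12⟩
  -- numeric facts
  have hK20 : (2 : ℝ) ^ 20 ≤ K ^ 20 := pow_le_pow_left₀ (by norm_num) (by linarith) 20
  have hK90 : (2 : ℝ) ^ 90 ≤ K ^ 90 := pow_le_pow_left₀ (by norm_num) (by linarith) 90
  have hε2 : (5 * ε) ^ 2 ≤ 1 / 1000 := by
    have h6 : 1 / (6 * K ^ 20) ≤ 1 / 25000 := by
      apply one_div_le_one_div_of_le (by norm_num); linarith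
    have : (5 * ε) ^ 2 = 25 * ε ^ 2 := by ring
    rw [this]; linarith
  have hK90' : 9 / K ^ 90 ≤ 1 / 1000 := by
    rw [div_le_div_iff₀ (by positivity) (by norm_num)]; linarith
  by_contra hlt'
  have hlt := not_le.1 hlt'
  have hmonoE := rotorCircuit_output_monotone hK0.le hX
  -- `Ψ = V + (2/K) ã` has derivative `≥ 0.97` on `J`
  have hmono := monotoneOn_sub_of_le_deriv (φ := fun _ => (97 : ℝ) / 100)
    (Φ := fun s => 97 / 100 * s) (convex_Icc t₀ t₁)
    (f := fun s => X s 0 * X s 3 * (ρ ^ 2 * (X s 2)⁻¹) + 2 / K * X s 4)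
    (fun s hs => by
      have hsI := hJI s hs
      have hcl : K ^ 100 * ρ ^ 2 ≤ X s 2 :=
        c_large hX h0 hε hρ hρε hM0 hK hεK hMρ hρexp hδ hon hτ1 hτ2 hcτ hcτeq hsI
      have hcne : X s 2 ≠ 0 := (lt_of_lt_of_le (by positivity) hcl).ne'
      exact (hasDerivAt_V hX hε.ne' hρ.ne' hcne).add ((hasDerivAt_e hX s).const_mul (2 / K)))
    (fun s _ => ((hasDerivAt_id s).const_mul ((97 : ℝ) / 100)).congr_deriv (by simp))
    (fun s hs => by
      have hsI := hJI s hs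
      have hs02 : s ∈ Icc (0 : ℝ) 2 := ⟨by linarith [hs.1, ht₀0], hsI.2⟩
      have hR :=
          V_remainder_le hX h0 hε hε1 hρ hρε hM0 hMK hK hεK hMρ hρexp hδ hon hτ1 hτ2 hcτ hcτeq hsI
      have hRlo := (abs_le.1 hR).1
      have hsum := traj_sum_sq_eq_one hX h0 s
      obtain ⟨hb5, hc5⟩ := bc_small hX h0 hε hρ hρε hM0.le hs02
      have hb2 : X s 1 ^ 2 ≤ (5 * ε) ^ 2 := by
        rw [← sq_abs]; exact pow_le_pow_left₀ (abs_nonneg _) hb5 2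
      have hc2 : X s 2 ^ 2 ≤ (5 * ε) ^ 2 := by
        rw [← sq_abs]; exact pow_le_pow_left₀ (abs_nonneg _) hc5 2
      have hes : X s 4 ≤ 1 / 10 := (hmonoE hs.2).trans hlt.le
      have hes0 : 0 ≤ X s 4 := e_nonneg hX h0 hK0.le hs02.1
      have he2 : X s 4 ^ 2 ≤ 1 / 100 := by
        have := pow_le_pow_left₀ hes0 hes 2; norm_num at this; exact this
      have hKd : 2 / K * (K * X s 3 ^ 2) = 2 * X s 3 ^ 2 := by field_simp
      rw [hKd]
      linarith)
  have hmem0 : t₀ ∈ Icc t₀ t₁ := ⟨le_rfl, h01⟩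
  have hmem1 : t₁ ∈ Icc t₀ t₁ := ⟨h01, le_rfl⟩
  have h := hmono hmem0 hmem1 h01
  simp only at h
  -- sizes of `V` at the endpoints and of `ã`
  have hV : ∀ s ∈ Icc t₀ t₁, |X s 0 * X s 3 * (ρ ^ 2 * (X s 2)⁻¹)| ≤ 1 / K ^ 100 := by
    intro s hs
    have hsI := hJI s hs
    have hcl : K ^ 100 * ρ ^ 2 ≤ X s 2 :=
      c_large hX h0 hε hρ hρε hM0 hK hεK hMρ hρexp hδ hon hτ1 hτ2 hcτ hcτeq hsI
    have hcpos : 0 < X s 2 := lt_of_lt_of_le (by positivity) hcl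
    have hq0 : 0 ≤ ρ ^ 2 * (X s 2)⁻¹ := by positivity
    have hq : ρ ^ 2 * (X s 2)⁻¹ ≤ 1 / K ^ 100 := by
      rw [← div_eq_mul_inv, div_le_div_iff₀ hcpos (by positivity), one_mul]; linarith
    rw [abs_mul, abs_mul, abs_of_nonneg hq0]
    calc |X s 0| * |X s 3| * (ρ ^ 2 * (X s 2)⁻¹) ≤ 1 * 1 * (1 / K ^ 100) :=
          mul_le_mul (mul_le_mul (traj_abs_le_one hX h0 s 0) (traj_abs_le_one hX h0 s 3) (abs_nonneg
            _)
            zero_le_one) hq hq0 (by norm_num)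
      _ = 1 / K ^ 100 := by ring
  have hV0 := (abs_le.1 (hV t₀ hmem0)).1
  have hV1 := (abs_le.1 (hV t₁ hmem1)).2
  have he0 : 0 ≤ X t₀ 4 := e_nonneg hX h0 hK0.le ht₀0
  have hlen : t₁ - t₀ = K⁻¹ := by simp only [ht₀, ht₁]; ring
  -- numeric contradiction, in the variable `u = 1/K`
  set u : ℝ := K⁻¹ with hu
  have hu0 : 0 < u := by positivity
  have hK8 : (2 : ℝ) ^ 8 ≤ K ^ 8 := pow_le_pow_left₀ (by norm_num) (by linarith) 8
  have hK99 : (2 : ℝ) ^ 8 ≤ K ^ 99 := hK8.trans (pow_le_pow_right₀ hK1 (by norm_num))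
  have hi99 : (K ^ 99)⁻¹ ≤ 1 / 256 := by
    rw [one_div, inv_le_inv₀ (by positivity) (by norm_num)]; linarith
  have h100 : 1 / K ^ 100 ≤ u * (1 / 256) := by
    rw [show 1 / K ^ 100 = u * (K ^ 99)⁻¹ by
      simp only [hu]; rw [← mul_inv, ← pow_succ', one_div]]
    exact mul_le_mul_of_nonneg_left hi99 hu0.le
  have hKu : 2 / K * X t₁ 4 - 2 / K * X t₀ 4 ≤ 2 * u * (1 / 10) := by
    have : 2 / K * X t₁ 4 - 2 / K * X t₀ 4 = 2 * u * (X t₁ 4 - X t₀ 4) := by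
      simp only [hu]; ring
    rw [this]
    exact mul_le_mul_of_nonneg_left (by linarith) (by positivity)
  have hfin : 97 / 100 * (t₁ - t₀) ≤ 2 * (u * (1 / 256)) + 2 * u * (1 / 10) := by linarith
  rw [hlen] at hfin
  linarith

end Summit.NavierStokesRegularity.FluidComputer.RotorKnob
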